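import Summits.BirchSwinnertonDyer.Rank1Residual.ManinAdditive.CuspidalKummerClass
import Summits.BirchSwinnertonDyer.BirchSwinnertonDyer.Theorems.ManinLocalTwoThreeEtaUnitSquareIffEven
import HarnessLib

/-!
# `EtaUnitSquareIffEven` holds (candidate E-an-49⁺ of cell bsd-f2-manin is a theorem)

Summit `BirchSwinnertonDyer`, sub-problem `Rank1Residual`, folder `ManinAdditive` (cell bsd-f2-manin, typer seat).
Sibling `…Holds` file of the conjecture leaf `CuspidalKummerClass.lean` (p610785), kept separate so that
the leaf stays a pure `@[conjecture]` leaf.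

The `@[conjecture]` row E-an-49⁺ `Summit.BirchSwinnertonDyer.Rank1Residual.ManinAdditive.CuspidalKummer.EtaUnitSquareIffEven`
("an `η`-unit series `g` with exponents `r` on a finite set of scales `S ∌ 0` is a `2`-adic square iff
every `r_δ` is even") is PROVED by the route seat bsd-line-manin23-p3 (gen 3):
`Summit.BirchSwinnertonDyer.BirchSwinnertonDyer.Theorems.ManinLocalTwoThree.etaUnitSquareIffEven`
(p610920, `Theorems/ManinLocalTwoThreeEtaUnitSquareIffEven.lean`; `⇐` squares of `η`-products,
`⇒` mod-`2` pentagonal-coefficient argument at the odd scales, p609843, and contraction `q² ↦ q` at the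
even scales, p610147), whose statement is the body of `EtaUnitSquareIffEven` with
`IsEtaUnitSeries` unfolded (definitionally).  This file records the discharge BY NAME:

* `EtaUnitSquareIffEven_holds : EtaUnitSquareIffEven`.

Nothing about BSD or Manin's conjecture is proved here; the other `@[conjecture]` rows of the leaf
(E-an-47/48/50/52/53/55–58) are untouched.
-/

namespace Summit.BirchSwinnertonDyer.Rank1Residual.ManinAdditive.CuspidalKummer

/-- **E-an-49⁺ is a theorem**: the `η`-unit-series square test `EtaUnitSquareIffEven` holds, by
`Summit.BirchSwinnertonDyer.BirchSwinnertonDyer.Theorems.ManinLocalTwoThree.etaUnitSquareIffEven`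
(p610920; the two statements agree definitionally, `IsEtaUnitSeries` unfolded). -/
theorem EtaUnitSquareIffEven_holds : EtaUnitSquareIffEven := fun S r g hS hg =>
  Summit.BirchSwinnertonDyer.BirchSwinnertonDyer.Theorems.ManinLocalTwoThree.etaUnitSquareIffEven
    S r g hS hg

end Summit.BirchSwinnertonDyer.Rank1Residual.ManinAdditive.CuspidalKummer
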